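import Literature.NumberTheory.GaloisRepresentations.SUnitsValuation
import HarnessLib

/-!
# `S`-units modulo units embed into `ℤ^{S_E}` by the valuations at the places above `S`

Topic `NumberTheory/GaloisRepresentations`; namespace `Literature.NumberTheory.GaloisRepresentations.SUnits`.  THEOREMS ONLY
(no definition, no named fact, no `sorry`, no instance).  Sequel of `SUnitsValuation.lean`
(`mem_sUnits_iff_forall_valuation_eq_one`: `x ∈ sUnits K S E ↔ w(x) = 0` at every finite place `w` of `E` not above `S`).

For a finite extension `E/K` of number fields and a set `S` of finite places of `K`, write `S_E = {w ∣ w.under ∈ S}` for the places of `E`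
above `S`.  The valuation vector `x ↦ (ord_w x)_{w ∈ S_E}` is a group homomorphism `𝒪_{E,S_E}^× = sUnits K S E → ℤ^{S_E}` whose KERNEL IS
EXACTLY THE GLOBAL UNITS `sUnits K ∅ E = 𝒪_E^×`:

* (`S` finite ⟹ `S_E` finite is the tree's `EquivariantSUnit.finite_setOf_under_mem`, `NumberFields/PlacesAboveGaloisOrbits.lean`;)
* `exists_valuationVector_ker_eq_units` — `∃ φ : sUnits K S E →* (S_E → Multiplicative ℤ)` with `(φ x w : ℤᵐ⁰) = w.valuation E x` and
  `φ x = 1 ↔ (x : Eˣ) ∈ sUnits K ∅ E`;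
* `mul_inv_mem_sUnits_empty_of_forall_valuation_eq` — elementary form: two `S`-units with the same valuations above `S` differ by a unit.

So `𝒪_{E,S_E}^×/𝒪_E^×` is a subgroup of the free abelian group `ℤ^{S_E}` of rank `#S_E` (Dirichlet–Hasse–Chevalley `S`-unit bookkeeping; the
equality of ranks is the `S`-unit theorem and is NOT claimed).  Consumer: the `S₂`-units-versus-units defect (R2-4) of the (α3) descent on the
deciding crux `PrintCf2RubinValueTwo.MainConjClauseAtSplitTwoQuadDA` of cell `bsd-print-cf2` (memo `ROW2-SPEC-w6g8.md`), where `#S_E` is bounded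
along the tower by `Theorems/PrintCf2RubinValueTwoTowerPlacesAboveTwo`.  HONEST FRAMING: textbook bookkeeping; nothing about BSD.

References: J. Neukirch, *Algebraic Number Theory* (1999) Ch. I §11 (11.6) and Ch. VI §1 (`S`-units, `v(x) = 0` for `v ∉ S`); Neukirch–Schmidt–
Wingberg, *Cohomology of Number Fields* (2008) VIII §3 (`E_{K,S}`, the map `E_S → ⊕_{v ∈ S} ℤ`).
-/

noncomputable section

open NumberField IsDedekindDomain Field

namespace Literature.NumberTheory.GaloisRepresentations.SUnits

variable {K : Type} [Field K] [NumberField K] (S : Set (HeightOneSpectrum (𝓞 K)))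
  {E : Type} [Field E] [NumberField E] [Algebra K E]

/-- **Two `S`-units with the same valuations at the places above `S` differ by a global unit** (`x·y⁻¹ ∈ sUnits K ∅ E = 𝒪_E^×`).
[cite: NeukirchSchmidtWingberg2008, VIII §3 (`E_{K,S} = 𝒪_{K,S}^×`, "`v(x) = 0` for `v ∉ S`")] [cite: NeukirchANT1999, Ch. VI §1] -/
theorem mul_inv_mem_sUnits_empty_of_forall_valuation_eq {x y : Eˣ} (hx : x ∈ sUnits K S E) (hy : y ∈ sUnits K S E)
    (h : ∀ w : HeightOneSpectrum (𝓞 E), w.under (𝓞 K) ∈ S → w.valuation E (x : E) = w.valuation E (y : E)) :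
    x * y⁻¹ ∈ sUnits K (∅ : Set (HeightOneSpectrum (𝓞 K))) E := by
  rw [mem_sUnits_iff_forall_valuation_eq_one]
  intro w _
  have hy0 : w.valuation E (y : E) ≠ 0 := (Valuation.ne_zero_iff _).2 y.ne_zero
  by_cases hw : w.under (𝓞 K) ∈ S
  · rw [Units.val_mul, Units.val_inv_eq_inv_val, map_mul, map_inv₀, h w hw, mul_inv_cancel₀ hy0]
  · rw [Units.val_mul, Units.val_inv_eq_inv_val, map_mul, map_inv₀, valuation_eq_one_of_mem_sUnits hx w hw,
      valuation_eq_one_of_mem_sUnits hy w hw, inv_one, mul_one]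

/-- **The valuation vector `𝒪_{E,S_E}^× → ℤ^{S_E}` with kernel the global units.** There is a group homomorphism
`φ : sUnits K S E →* (S_E → Multiplicative ℤ)` (`S_E = {w ∣ w.under ∈ S}`) whose `w`-component is the normalised valuation,
`(φ x w : ℤᵐ⁰) = w.valuation E x`, and whose kernel is `sUnits K ∅ E = 𝒪_E^×`: `φ x = 1 ↔ (x : Eˣ) ∈ sUnits K ∅ E`. Hence
`𝒪_{E,S_E}^×/𝒪_E^× ↪ ℤ^{S_E}` (free abelian of rank `#S_E`; the `S`-unit theorem's rank equality is not claimed).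
[cite: NeukirchSchmidtWingberg2008, VIII §3] [cite: NeukirchANT1999, Ch. VI §1] -/
theorem exists_valuationVector_ker_eq_units :
    ∃ φ : sUnits K S E →* ({w : HeightOneSpectrum (𝓞 E) // w.under (𝓞 K) ∈ S} → Multiplicative ℤ),
      (∀ (x : sUnits K S E) (w : {w : HeightOneSpectrum (𝓞 E) // w.under (𝓞 K) ∈ S}),
          ((φ x w : Multiplicative ℤ) : WithZero (Multiplicative ℤ)) = w.1.valuation E ((x : Eˣ) : E)) ∧
      ∀ x : sUnits K S E, φ x = 1 ↔ (x : Eˣ) ∈ sUnits K (∅ : Set (HeightOneSpectrum (𝓞 K))) E := by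
  classical
  -- the `w`-component: `Eˣ → (ℤᵐ⁰)ˣ ≃ Multiplicative ℤ`
  let φw : HeightOneSpectrum (𝓞 E) → (Eˣ →* Multiplicative ℤ) := fun w ↦
    (WithZero.unitsWithZeroEquiv (α := Multiplicative ℤ)).toMonoidHom.comp
      (Units.map (w.valuation E).toMonoidWithZeroHom.toMonoidHom)
  have hφw : ∀ (w : HeightOneSpectrum (𝓞 E)) (x : Eˣ),
      ((φw w x : Multiplicative ℤ) : WithZero (Multiplicative ℤ)) = w.valuation E (x : E) := by
    intro w x
    change ((WithZero.unitsWithZeroEquiv (Units.map (w.valuation E).toMonoidWithZeroHom.toMonoidHom x) : Multiplicative ℤ) :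
        WithZero (Multiplicative ℤ)) = _
    rw [WithZero.coe_unitsWithZeroEquiv_eq_units_val, Units.coe_map]
    rfl
  let φ : sUnits K S E →* ({w : HeightOneSpectrum (𝓞 E) // w.under (𝓞 K) ∈ S} → Multiplicative ℤ) :=
    (MonoidHom.pi fun w : {w : HeightOneSpectrum (𝓞 E) // w.under (𝓞 K) ∈ S} ↦ φw w.1).comp (sUnits K S E).subtype
  refine ⟨φ, fun x w ↦ hφw w.1 x, fun x ↦ ?_⟩
  have hcomp : ∀ w : {w : HeightOneSpectrum (𝓞 E) // w.under (𝓞 K) ∈ S}, φ x w = φw w.1 (x : Eˣ) := fun w ↦ rfl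
  constructor
  · intro hφ
    rw [mem_sUnits_iff_forall_valuation_eq_one]
    intro w _
    by_cases hw : w.under (𝓞 K) ∈ S
    · have h1 : φw w (x : Eˣ) = 1 := by rw [← hcomp ⟨w, hw⟩, hφ]; rfl
      rw [← hφw w, h1]; rfl
    · exact valuation_eq_one_of_mem_sUnits x.2 w hw
  · intro hx
    funext w
    have h1 : w.1.valuation E ((x : Eˣ) : E) = 1 :=
      valuation_eq_one_of_mem_sUnits hx w.1 (Set.notMem_empty _)
    have h2 : ((φw w.1 (x : Eˣ) : Multiplicative ℤ) : WithZero (Multiplicative ℤ)) = ((1 : Multiplicative ℤ) : WithZero (Multiplicative ℤ)) := by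
      rw [hφw, h1]; rfl
    rw [hcomp]
    exact WithZero.coe_injective h2

end Literature.NumberTheory.GaloisRepresentations.SUnits

end
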